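import Mathlib

/-!
# Crux-triage r1 (triager 3, gen 2) — kernel-checked witnesses for `stmt-ValiantsHypothesis-3998`

Small certificates behind TRIAGE-r1-3.md (no `sorry`):

* `socleTiling` — the `Prop` `SocleTiling` of `Cruxes/FeketeBoundedFanin/Sketch-ideator1.lean`, PROVED:
  over any commutative ring `1 + X·(Σ_{i<a} X^i)·(Σ_{j<b} X^{aj}) = Σ_{m ≤ ab} X^m`.
* `geom_sum_eq_X_sub_one_pow` — the char-`p` socle `Σ_{m<p} X^m = (X − 1)^{p−1}` in `(ZMod p)[X]`.
* `tiling_eq_socle`, `ufa_witness_dvd` — with `ab = p − 1`: `X·G_a(X)·G_b(X^a) + 1 = (X − 1)^{p−1}`, so the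
  UFA data `P = (X·G_a, G_b(X^a))`, `Q = (1,1)`, `c = −1` (sizes `a + b + 2`) osculate to order `p − 1 < p`:
  the witness against `WittPascal.UnipotentFewnomialABC C₀` (every `C₀`) and, read as `U·V ≡ −1 (mod (X−1)^{p−1})`,
  against `Ideator3.ReciprocalRigidity` even after the Frobenius case is excluded.
* `frobenius_cheat` — `(X − 1)^N ∣ X^j·X^{p−j} − 1` for all `N ≤ p`: `ReciprocalRigidity` as typed fails with `|U|+|V| = 2`.
-/

set_option linter.dupNamespace false

open Polynomial Finset BigOperators

namespace Summit.ValiantsHypothesis.ValiantsHypothesis.Cruxes.FeketeBoundedFanin.TriageR1K3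

/-- Block geometric series `(Σ_{i<m} x^i)(Σ_{j<n} x^{mj}) = Σ_{l<mn} x^l`. [folklore] -/
theorem geom_block {R : Type*} [CommRing R] (x : R[X]) (m n : ℕ) :
    (∑ i ∈ range m, x ^ i) * (∑ j ∈ range n, x ^ (m * j)) = ∑ l ∈ range (m * n), x ^ l := by
  induction n with
  | zero => simp
  | succ n ih =>
    rw [Finset.sum_range_succ, mul_add, ih, Nat.mul_succ, Finset.sum_range_add, Finset.sum_mul]
    congr 1
    refine Finset.sum_congr rfl fun i _ => ?_
    rw [← pow_add, add_comm]

/-- `SocleTiling` (Sketch-ideator1, stated there as a `Prop`) — proved. [folklore] -/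
theorem socleTiling (R : Type) [CommRing R] (a b : ℕ) :
    (1 : R[X]) + X * (∑ i ∈ Finset.range a, X ^ i) * (∑ j ∈ Finset.range b, X ^ (a * j)) =
      ∑ m ∈ Finset.range (a * b + 1), X ^ m := by
  rw [mul_assoc, geom_block, Finset.sum_range_succ', pow_zero, add_comm, Finset.mul_sum]
  congr 1
  refine Finset.sum_congr rfl fun m _ => ?_
  rw [pow_succ, mul_comm]

/-- The char-`p` socle: `Σ_{m<p} X^m = (X − 1)^{p−1}` in `(ZMod p)[X]`. [folklore] -/
theorem geom_sum_eq_X_sub_one_pow (p : ℕ) [hp : Fact p.Prime] :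
    (∑ m ∈ Finset.range p, (X : (ZMod p)[X]) ^ m) = (X - 1) ^ (p - 1) := by
  have h1 : ((X : (ZMod p)[X]) - 1) ^ p = X ^ p - 1 := by
    have h := sub_pow_char (X : (ZMod p)[X]) 1
    rwa [one_pow] at h
  have hg : (∑ m ∈ Finset.range p, (X : (ZMod p)[X]) ^ m) * (X - 1) = X ^ p - 1 := geom_sum_mul X p
  have hne : (X : (ZMod p)[X]) - 1 ≠ 0 := by
    have := X_sub_C_ne_zero (1 : ZMod p)
    rwa [map_one] at this
  apply mul_right_cancel₀ hne
  rw [hg, ← h1, ← pow_succ, Nat.sub_add_cancel hp.out.one_lt.le]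

/-- With `ab = p − 1`: `X·G_a(X)·G_b(X^a) + 1 = (X − 1)^{p−1}` in characteristic `p` — an `a`-nomial times a
`b`-nomial is `≡ −1` at `X = 1` to order `p − 1` (support `a + b ≈ 2√p` when `a ≈ b`). [folklore] -/
theorem tiling_eq_socle (p : ℕ) [Fact p.Prime] (a b : ℕ) (hab : a * b = p - 1) :
    (X : (ZMod p)[X]) * (∑ i ∈ Finset.range a, X ^ i) * (∑ j ∈ Finset.range b, X ^ (a * j)) + 1 =
      (X - 1) ^ (p - 1) := by
  have hp1 : 1 ≤ p := (Fact.out : p.Prime).one_lt.le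
  rw [add_comm, socleTiling, hab, Nat.sub_add_cancel hp1, geom_sum_eq_X_sub_one_pow]

/-- UFA witness: `(X − C 1)^{p−1} ∣ ∏P − C c·∏Q` for `P = (X·G_a, G_b(X^a))`, `Q = (1, 1)`, `c = −1`, `ab = p − 1`.
(Order `p − 1` is `< p`, so the Frobenius disjunct of `UnipotentFewnomialABC` is off, while `C₀ 2 · (a + b + 2) < p − 1`
as soon as `a = 2·C₀ 2 + 2` and `p ≡ 1 (mod a)` is a large prime — `Nat.exists_prime_gt_modEq_one`.) [folklore] -/
theorem ufa_witness_dvd (p : ℕ) [Fact p.Prime] (a b : ℕ) (hab : a * b = p - 1) :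
    ((X : (ZMod p)[X]) - C 1) ^ (p - 1) ∣
      (X * ∑ i ∈ Finset.range a, X ^ i) * (∑ j ∈ Finset.range b, X ^ (a * j)) - C (-1 : ZMod p) * (1 * 1) := by
  rw [map_neg, map_one, neg_mul, one_mul, one_mul, sub_neg_eq_add, tiling_eq_socle p a b hab]

/-- Frobenius cheat against `ReciprocalRigidity` as typed: `(X − 1)^N ∣ X^j·X^{p−j} − C 1` for every `N ≤ p`,
with `X^j·X^{p−j} = X^p ≠ C 1` and `|supp X^j| + |supp X^{p−j}| = 2`. [folklore] -/
theorem frobenius_cheat (p : ℕ) [Fact p.Prime] (j N : ℕ) (hj : j ≤ p) (hN : N ≤ p) :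
    ((X : (ZMod p)[X]) - 1) ^ N ∣ X ^ j * X ^ (p - j) - C 1 := by
  rw [← pow_add, Nat.add_sub_cancel' hj, map_one]
  have h1 : ((X : (ZMod p)[X]) - 1) ^ p = X ^ p - 1 := by
    have h := sub_pow_char (X : (ZMod p)[X]) 1
    rwa [one_pow] at h
  rw [← h1]
  exact pow_dvd_pow _ hN

end Summit.ValiantsHypothesis.ValiantsHypothesis.Cruxes.FeketeBoundedFanin.TriageR1K3
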